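import Literature.NumberTheory.LFunctions.Zhang2022.DetectorDoublingAtoms

/-!
# The doubling identity (K2 / D1), part B: exponential extremals, the clamped solve, the jet map

Sub-cell E of the `landau-siegel` programme, row S-E-p5-12 (E-102 head 2, KERNEL PLAN OF RECORD = DOUBLING,
ls-barrier-plan g1 2026-08-27T01:45:23Z / 01:54:52Z; statement shapes = ls-barrier-num g2's ShadowKernelSketch
1268210b689bb6c5; proof skeleton = ls-barrier-num g2 2026-08-27T01:53:01Z; symbolic confirmation kit j265090/j265247,
float check `k2_float_check.py`). ORIENTATION (planner ruling (3)): PERIODIC — the Euler–Lagrange extremal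
`F = γ₀ + Σ_m γ_(m+1) e^(−iπ b_m t)` of the bulk form on `[0,1]`, CLAMPED at `t = 0`, with data `(F, F′)(1) = (x₁, x₂)`.

This file (part B) lands: the exponential extremals `extremal/extremalD/extremalDD/extremalDDD b γ` (ShadowKernelSketch
shapes), the 12-term polynomial `dblQ` (`det` of the clamped interpolation `= π²·Q`; `c₀ = Q/D`·const), the EXPLICIT
clamped coefficients `clampedCoeff b x₁ x₂` (Cramer data of kit j265090 = ls-barrier-num CRAMER-DATA f6ee39f0058ab204,
periodic orientation), the four boundary conditions `F⋆(0) = F⋆′(0) = 0`, `(F⋆, F⋆′)(1) = (x₁, x₂)` (GIVEN `Q ≠ 0`), and the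
JET MAP at the data end (ls-barrier-num 2026-08-27T01:53:01Z (2); GIVEN `Q ≠ 0` and pairwise-distinct `b`):
`2c₀·F⋆″(1) = π²·conj(A_N)·x₁ + (2π·Im A_b − πe₁·Im A₀ − iπe₁c₀)·x₂`,
`2c₀·(F⋆‴(1) + iπe₁F⋆″(1)) = (π³e₃·Im A₀ + iπ³e₃c₀)·x₁ + (2π²e₂c₀ − π²A_N)·x₂` (`c₀ = Re A₀`) — each ONE `field_simp`/`ring`
identity over the atoms `u_m`, `π`, `b` (two of them under `set_option maxRecDepth 20000`: deep terms, default heartbeats).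
Part C (`DetectorDoublingIdentity`) proves the integration-by-parts identity for the bulk energy of an extremal and
the assembled doubling identity `c₀·T_b^([0,1])(F⋆_x) = freeEndForm b x₁ x₂`. Nothing here asserts anything
about `L`-functions. -/

noncomputable section

open Complex Real ComplexConjugate

namespace Literature.NumberTheory.LFunctions.Zhang2022

namespace Det

/-! ### Exponential extremals on the span `{1, e^(−iπb_m t)}` -/

/-- An Euler–Lagrange extremal of the bulk form: `F = γ₀ + Σ_m γ_(m+1) e^(−iπ b_m t)`. [cite: Zhang2022LandauSiegel, §7 Prop. 7.1 p.44] -/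
def extremal (b : Fin 3 → ℝ) (γ : Fin 4 → ℂ) (t : ℝ) : ℂ :=
  γ 0 + ∑ m : Fin 3, γ m.succ * cexp (-(I * π * (b m : ℂ) * t))

/-- Its derivative `F′`. [cite: Zhang2022LandauSiegel, §7 Prop. 7.1 p.44] -/
def extremalD (b : Fin 3 → ℝ) (γ : Fin 4 → ℂ) (t : ℝ) : ℂ :=
  ∑ m : Fin 3, γ m.succ * (-(I * π * (b m : ℂ))) * cexp (-(I * π * (b m : ℂ) * t))

/-- Its second derivative `F″`. [cite: Zhang2022LandauSiegel, §7 Prop. 7.1 p.44] -/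
def extremalDD (b : Fin 3 → ℝ) (γ : Fin 4 → ℂ) (t : ℝ) : ℂ :=
  ∑ m : Fin 3, γ m.succ * (-(I * π * (b m : ℂ))) ^ 2 * cexp (-(I * π * (b m : ℂ) * t))

/-- Its third derivative `F‴`. [cite: Zhang2022LandauSiegel, §7 Prop. 7.1 p.44] -/
def extremalDDD (b : Fin 3 → ℝ) (γ : Fin 4 → ℂ) (t : ℝ) : ℂ :=
  ∑ m : Fin 3, γ m.succ * (-(I * π * (b m : ℂ))) ^ 3 * cexp (-(I * π * (b m : ℂ) * t))

/-! ### The clamped extremal with prescribed data at the far end (explicit Cramer solve) -/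

/-- The 12-term polynomial `Q(b, u)`: the determinant of the clamped interpolation system is `π²·Q` and
`c₀(b) = Q/(2u₀u₁u₂·(b₀−b₁)(b₀−b₂)(b₁−b₂))` (kit j265090). [cite: Zhang2022LandauSiegel, §7 Prop. 7.1 p.44, (7.19)–(7.21)] -/
def dblQ (b : Fin 3 → ℝ) : ℂ :=
  -(b 0 : ℂ) * (b 1 : ℂ) * halfUnit b 0^2 * halfUnit b 2^2 + (b 0 : ℂ) * (b 1 : ℂ) * halfUnit b 0^2 + (b 0 : ℂ) * (b 1 : ℂ) * halfUnit b 1^2 * halfUnit b 2^2 - (b 0 : ℂ) * (b 1 : ℂ) * halfUnit b 1^2 + (b 0 : ℂ) * (b 2 : ℂ) * halfUnit b 0^2 * halfUnit b 1^2 - (b 0 : ℂ) * (b 2 : ℂ) * halfUnit b 0^2 - (b 0 : ℂ) * (b 2 : ℂ) * halfUnit b 1^2 * halfUnit b 2^2 + (b 0 : ℂ) * (b 2 : ℂ) * halfUnit b 2^2 - (b 1 : ℂ) * (b 2 : ℂ) * halfUnit b 0^2 * halfUnit b 1^2 + (b 1 : ℂ) * (b 2 : ℂ) * halfUnit b 0^2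 * halfUnit b 2^2 + (b 1 : ℂ) * (b 2 : ℂ) * halfUnit b 1^2 - (b 1 : ℂ) * (b 2 : ℂ) * halfUnit b 2^2

/-- Coefficient `γ_0(x₁, x₂)` of the clamped extremal (explicit Cramer quotient over `Q`).
[cite: Zhang2022LandauSiegel, §7 Prop. 7.1 p.44, (7.19)–(7.21)] -/
def clampedCoeff0 (b : Fin 3 → ℝ) (x₁ x₂ : ℂ) : ℂ :=
  ((-(b 0 : ℂ) * (b 1 : ℂ) * halfUnit b 0^2 * halfUnit b 2^2 + (b 0 : ℂ) * (b 1 : ℂ) * halfUnit b 1^2 * halfUnit b 2^2 + (b 0 : ℂ) * (b 2 : ℂ) * halfUnit b 0^2 * halfUnit b 1^2 - (b 0 : ℂ) * (b 2 : ℂ) * halfUnit b 1^2 * halfUnit b 2^2 - (b 1 : ℂ) * (b 2 : ℂ) * halfUnit b 0^2 * halfUnit b 1^2 + (b 1 : ℂ) * (b 2 : ℂ) * halfUnit b 0^2 * halfUnit b 2^2) * x₁ - I * ((b 0 : ℂ) * halfUnit b 0^2 * halfUnit b 1^2 - (b 0 : ℂ) * halfUnit b 0^2 * halfUnit b 2^2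 - (b 1 : ℂ) * halfUnit b 0^2 * halfUnit b 1^2 + (b 1 : ℂ) * halfUnit b 1^2 * halfUnit b 2^2 + (b 2 : ℂ) * halfUnit b 0^2 * halfUnit b 2^2 - (b 2 : ℂ) * halfUnit b 1^2 * halfUnit b 2^2) * x₂ / (π : ℂ)) / dblQ b

/-- Coefficient `γ_1(x₁, x₂)` of the clamped extremal (explicit Cramer quotient over `Q`).
[cite: Zhang2022LandauSiegel, §7 Prop. 7.1 p.44, (7.19)–(7.21)] -/
def clampedCoeff1 (b : Fin 3 → ℝ) (x₁ x₂ : ℂ) : ℂ :=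
  halfUnit b 0 ^ 2 * (((b 1 : ℂ) * (b 2 : ℂ) * (halfUnit b 1 - halfUnit b 2) * (halfUnit b 1 + halfUnit b 2)) * x₁ - I * (-(b 1 : ℂ) * halfUnit b 1^2 * halfUnit b 2^2 + (b 1 : ℂ) * halfUnit b 1^2 + (b 2 : ℂ) * halfUnit b 1^2 * halfUnit b 2^2 - (b 2 : ℂ) * halfUnit b 2^2) * x₂ / (π : ℂ)) / dblQ b

/-- Coefficient `γ_2(x₁, x₂)` of the clamped extremal (explicit Cramer quotient over `Q`).
[cite: Zhang2022LandauSiegel, §7 Prop. 7.1 p.44, (7.19)–(7.21)] -/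
def clampedCoeff2 (b : Fin 3 → ℝ) (x₁ x₂ : ℂ) : ℂ :=
  halfUnit b 1 ^ 2 * ((-(b 0 : ℂ) * (b 2 : ℂ) * (halfUnit b 0 - halfUnit b 2) * (halfUnit b 0 + halfUnit b 2)) * x₁ - I * ((b 0 : ℂ) * halfUnit b 0^2 * halfUnit b 2^2 - (b 0 : ℂ) * halfUnit b 0^2 - (b 2 : ℂ) * halfUnit b 0^2 * halfUnit b 2^2 + (b 2 : ℂ) * halfUnit b 2^2) * x₂ / (π : ℂ)) / dblQ b

/-- Coefficient `γ_3(x₁, x₂)` of the clamped extremal (explicit Cramer quotient over `Q`).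
[cite: Zhang2022LandauSiegel, §7 Prop. 7.1 p.44, (7.19)–(7.21)] -/
def clampedCoeff3 (b : Fin 3 → ℝ) (x₁ x₂ : ℂ) : ℂ :=
  halfUnit b 2 ^ 2 * (((b 0 : ℂ) * (b 1 : ℂ) * (halfUnit b 0 - halfUnit b 1) * (halfUnit b 0 + halfUnit b 1)) * x₁ - I * (-(b 0 : ℂ) * halfUnit b 0^2 * halfUnit b 1^2 + (b 0 : ℂ) * halfUnit b 0^2 + (b 1 : ℂ) * halfUnit b 0^2 * halfUnit b 1^2 - (b 1 : ℂ) * halfUnit b 1^2) * x₂ / (π : ℂ)) / dblQ b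

/-- The coefficient vector `γ(x₁, x₂)` of the extremal CLAMPED at `t = 0` (`F(0) = F′(0) = 0`) with data
`(F, F′)(1) = (x₁, x₂)` — explicit Cramer quotients over `Q` (kit j265090 / ls-barrier-num CRAMER-DATA f6ee39f0058ab204,
translated to the periodic orientation by `γ_m ↦ γ_m·u_m²`). [cite: Zhang2022LandauSiegel, §7 Prop. 7.1 p.44, (7.19)–(7.21)] -/
def clampedCoeff (b : Fin 3 → ℝ) (x₁ x₂ : ℂ) : Fin 4 → ℂ :=
  ![clampedCoeff0 b x₁ x₂, clampedCoeff1 b x₁ x₂, clampedCoeff2 b x₁ x₂, clampedCoeff3 b x₁ x₂]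

/-- Entry `0`. [cite: Zhang2022LandauSiegel, §7 Prop. 7.1 p.44, (7.19)–(7.21)] -/
@[simp] theorem clampedCoeff_zero (b : Fin 3 → ℝ) (x₁ x₂ : ℂ) : clampedCoeff b x₁ x₂ 0 = clampedCoeff0 b x₁ x₂ := rfl

/-- Entry `succ 0`. [cite: Zhang2022LandauSiegel, §7 Prop. 7.1 p.44, (7.19)–(7.21)] -/
@[simp] theorem clampedCoeff_succ_zero (b : Fin 3 → ℝ) (x₁ x₂ : ℂ) :
    clampedCoeff b x₁ x₂ (Fin.succ 0) = clampedCoeff1 b x₁ x₂ := rfl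

/-- Entry `succ 1`. [cite: Zhang2022LandauSiegel, §7 Prop. 7.1 p.44, (7.19)–(7.21)] -/
@[simp] theorem clampedCoeff_succ_one (b : Fin 3 → ℝ) (x₁ x₂ : ℂ) :
    clampedCoeff b x₁ x₂ (Fin.succ 1) = clampedCoeff2 b x₁ x₂ := rfl

/-- Entry `succ 2`. [cite: Zhang2022LandauSiegel, §7 Prop. 7.1 p.44, (7.19)–(7.21)] -/
@[simp] theorem clampedCoeff_succ_two (b : Fin 3 → ℝ) (x₁ x₂ : ℂ) :
    clampedCoeff b x₁ x₂ (Fin.succ 2) = clampedCoeff3 b x₁ x₂ := rfl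

/-- The clamped extremal `F⋆_x`. [cite: Zhang2022LandauSiegel, §7 Prop. 7.1 p.44] -/
def clampedExt (b : Fin 3 → ℝ) (x₁ x₂ : ℂ) : ℝ → ℂ := extremal b (clampedCoeff b x₁ x₂)

section Clamped

variable (b : Fin 3 → ℝ) (x₁ x₂ : ℂ)

/-- Simp set evaluating an extremal built on `clampedCoeff` at `t = 0` and `t = 1`. [folklore] -/
private theorem eval_aux (b : Fin 3 → ℝ) (m : Fin 3) :
    cexp (-(I * π * (b m : ℂ) * ((1 : ℝ) : ℂ))) = ((halfUnit b m) ^ 2)⁻¹ ∧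
      cexp (-(I * π * (b m : ℂ) * ((0 : ℝ) : ℂ))) = 1 := by
  refine ⟨?_, by simp⟩
  rw [Complex.ofReal_one, mul_one]
  exact cexp_neg_eq_halfUnit b m

/-- `F⋆(0) = 0` (clamped). [cite: Zhang2022LandauSiegel, §7 Prop. 7.1 p.44] -/
theorem clampedExt_zero (hQ : dblQ b ≠ 0) : extremal b (clampedCoeff b x₁ x₂) 0 = 0 := by
  have hπ : (π : ℂ) ≠ 0 := by exact_mod_cast Real.pi_ne_zero
  have h0 := halfUnit_ne_zero b 0; have h1 := halfUnit_ne_zero b 1; have h2 := halfUnit_ne_zero b 2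
  unfold extremal
  simp only [Fin.sum_univ_three, clampedCoeff_zero, clampedCoeff_succ_zero, clampedCoeff_succ_one, clampedCoeff_succ_two, (eval_aux b 0).2, (eval_aux b 1).2, (eval_aux b 2).2, mul_one]
  simp only [clampedCoeff0, clampedCoeff1, clampedCoeff2, clampedCoeff3]
  field_simp
  unfold dblQ
  ring

/-- `F⋆′(0) = 0` (clamped). [cite: Zhang2022LandauSiegel, §7 Prop. 7.1 p.44] -/
theorem clampedExtD_zero (hQ : dblQ b ≠ 0) : extremalD b (clampedCoeff b x₁ x₂) 0 = 0 := by
  have hπ : (π : ℂ) ≠ 0 := by exact_mod_cast Real.pi_ne_zero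
  have h0 := halfUnit_ne_zero b 0; have h1 := halfUnit_ne_zero b 1; have h2 := halfUnit_ne_zero b 2
  unfold extremalD
  simp only [Fin.sum_univ_three, clampedCoeff_succ_zero, clampedCoeff_succ_one, clampedCoeff_succ_two, (eval_aux b 0).2,
    (eval_aux b 1).2, (eval_aux b 2).2, mul_one]
  simp only [clampedCoeff1, clampedCoeff2, clampedCoeff3]
  field_simp
  unfold dblQ
  ring

/-- `F⋆(1) = x₁` (data). [cite: Zhang2022LandauSiegel, §7 Prop. 7.1 p.44] -/
theorem clampedExt_one (hQ : dblQ b ≠ 0) : extremal b (clampedCoeff b x₁ x₂) 1 = x₁ := by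
  have hπ : (π : ℂ) ≠ 0 := by exact_mod_cast Real.pi_ne_zero
  have h0 := halfUnit_ne_zero b 0; have h1 := halfUnit_ne_zero b 1; have h2 := halfUnit_ne_zero b 2
  unfold extremal
  simp only [Fin.sum_univ_three, clampedCoeff_zero, clampedCoeff_succ_zero, clampedCoeff_succ_one, clampedCoeff_succ_two, (eval_aux b 0).1, (eval_aux b 1).1, (eval_aux b 2).1]
  simp only [clampedCoeff0, clampedCoeff1, clampedCoeff2, clampedCoeff3]
  field_simp
  unfold dblQ
  ring

/-- `F⋆′(1) = x₂` (data). [cite: Zhang2022LandauSiegel, §7 Prop. 7.1 p.44] -/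
theorem clampedExtD_one (hQ : dblQ b ≠ 0) : extremalD b (clampedCoeff b x₁ x₂) 1 = x₂ := by
  have hπ : (π : ℂ) ≠ 0 := by exact_mod_cast Real.pi_ne_zero
  have h0 := halfUnit_ne_zero b 0; have h1 := halfUnit_ne_zero b 1; have h2 := halfUnit_ne_zero b 2
  unfold extremalD
  simp only [Fin.sum_univ_three, clampedCoeff_succ_zero, clampedCoeff_succ_one, clampedCoeff_succ_two, (eval_aux b 0).1, (eval_aux b 1).1, (eval_aux b 2).1]
  simp only [clampedCoeff1, clampedCoeff2, clampedCoeff3]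
  field_simp
  unfold dblQ
  ring_nf
  simp only [Complex.I_sq]
  ring_nf

/-! ### The jet map at the data end -/


/-- `(−iπz)² = −π²z²`. [folklore] -/
private theorem negIpi_sq (z : ℂ) : (-(I * (π : ℂ) * z)) ^ 2 = -((π : ℂ) ^ 2 * z ^ 2) := by
  have : I ^ 2 = -1 := Complex.I_sq
  linear_combination ((π : ℂ) ^ 2 * z ^ 2) * this

/-- `(−iπz)³ = iπ³z³`. [folklore] -/
private theorem negIpi_cube (z : ℂ) : (-(I * (π : ℂ) * z)) ^ 3 = I * ((π : ℂ) ^ 3 * z ^ 3) := by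
  have : I ^ 2 = -1 := Complex.I_sq
  linear_combination (-(I * (π : ℂ) ^ 3 * z ^ 3)) * this

set_option maxRecDepth 20000 in
/-- **JET MAP, second derivative**: `2c₀·F⋆″(1) = π²·conj(A_N)·x₁ + (2π·ImA_b − πe₁·ImA₀ − iπe₁c₀)·x₂`
(ls-barrier-num 2026-08-27T01:53:01Z (2), constants `α, β`). [cite: Zhang2022LandauSiegel, §7 Prop. 7.1 p.44; §8 (8.11)–(8.18)] -/
theorem clampedExtDD_one (h01 : b 0 ≠ b 1) (h02 : b 0 ≠ b 2) (h12 : b 1 ≠ b 2) (hQ : dblQ b ≠ 0) :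
    2 * ((atomA0 b).re : ℂ) * extremalDD b (clampedCoeff b x₁ x₂) 1 =
      (π : ℂ) ^ 2 * conj (atomAN b) * x₁ +
        (2 * (π : ℂ) * ((atomAb b).im : ℂ) - (π : ℂ) * ((b 0 + b 1 + b 2 : ℝ) : ℂ) * ((atomA0 b).im : ℂ) -
          I * (π : ℂ) * ((b 0 + b 1 + b 2 : ℝ) : ℂ) * ((atomA0 b).re : ℂ)) * x₂ := by
  have hπ : (π : ℂ) ≠ 0 := by exact_mod_cast Real.pi_ne_zero
  have h0 := halfUnit_ne_zero b 0; have h1 := halfUnit_ne_zero b 1; have h2 := halfUnit_ne_zero b 2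
  have h01' : ((b 0 : ℝ) : ℂ) - (b 1 : ℂ) ≠ 0 := by
    rw [sub_ne_zero]; exact_mod_cast h01
  have h02' : ((b 0 : ℝ) : ℂ) - (b 2 : ℂ) ≠ 0 := by
    rw [sub_ne_zero]; exact_mod_cast h02
  have h12' : ((b 1 : ℝ) : ℂ) - (b 2 : ℂ) ≠ 0 := by
    rw [sub_ne_zero]; exact_mod_cast h12
  have h10' : ((b 1 : ℝ) : ℂ) - (b 0 : ℂ) ≠ 0 := by
    rw [sub_ne_zero]; exact_mod_cast (Ne.symm h01)
  have h20' : ((b 2 : ℝ) : ℂ) - (b 0 : ℂ) ≠ 0 := by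
    rw [sub_ne_zero]; exact_mod_cast (Ne.symm h02)
  have h21' : ((b 2 : ℝ) : ℂ) - (b 1 : ℂ) ≠ 0 := by
    rw [sub_ne_zero]; exact_mod_cast (Ne.symm h12)
  have hD := dblD_ne_zero b h01 h02 h12
  have hI : I ≠ 0 := Complex.I_ne_zero
  rw [re_atomA0_closed b h01 h02 h12, im_atomA0_closed b h01 h02 h12, im_atomAb_closed b h01 h02 h12,
    conj_atomAN_closed b h01 h02 h12]
  unfold extremalDD
  simp only [Fin.sum_univ_three, clampedCoeff_succ_zero, clampedCoeff_succ_one, clampedCoeff_succ_two, (eval_aux b 0).1,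
    (eval_aux b 1).1, (eval_aux b 2).1]
  simp only [clampedCoeff1, clampedCoeff2, clampedCoeff3]
  push_cast
  field_simp
  unfold dblQ
  ring_nf
  simp only [Complex.I_sq, Complex.I_pow_three, Complex.I_pow_four]
  ring_nf

set_option maxRecDepth 20000 in
/-- **JET MAP, third derivative**: `2c₀·(F⋆‴(1) + iπe₁F⋆″(1)) = (π³e₃·ImA₀ + iπ³e₃c₀)·x₁ + (2π²e₂c₀ − π²A_N)·x₂`
(ls-barrier-num 2026-08-27T01:53:01Z (2), constants `γ₀, γ₁`). [cite: Zhang2022LandauSiegel, §7 Prop. 7.1 p.44; §8 (8.11)–(8.18)] -/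
theorem clampedExtDDD_one (h01 : b 0 ≠ b 1) (h02 : b 0 ≠ b 2) (h12 : b 1 ≠ b 2) (hQ : dblQ b ≠ 0) :
    2 * ((atomA0 b).re : ℂ) * (extremalDDD b (clampedCoeff b x₁ x₂) 1 +
        I * (π : ℂ) * ((b 0 + b 1 + b 2 : ℝ) : ℂ) * extremalDD b (clampedCoeff b x₁ x₂) 1) =
      ((π : ℂ) ^ 3 * ((b 0 * b 1 * b 2 : ℝ) : ℂ) * ((atomA0 b).im : ℂ) +
          I * (π : ℂ) ^ 3 * ((b 0 * b 1 * b 2 : ℝ) : ℂ) * ((atomA0 b).re : ℂ)) * x₁ +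
        (2 * (π : ℂ) ^ 2 * ((b 0 * b 1 + b 1 * b 2 + b 2 * b 0 : ℝ) : ℂ) * ((atomA0 b).re : ℂ) -
          (π : ℂ) ^ 2 * atomAN b) * x₂ := by
  have hπ : (π : ℂ) ≠ 0 := by exact_mod_cast Real.pi_ne_zero
  have h0 := halfUnit_ne_zero b 0; have h1 := halfUnit_ne_zero b 1; have h2 := halfUnit_ne_zero b 2
  have h01' : ((b 0 : ℝ) : ℂ) - (b 1 : ℂ) ≠ 0 := by
    rw [sub_ne_zero]; exact_mod_cast h01
  have h02' : ((b 0 : ℝ) : ℂ) - (b 2 : ℂ) ≠ 0 := by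
    rw [sub_ne_zero]; exact_mod_cast h02
  have h12' : ((b 1 : ℝ) : ℂ) - (b 2 : ℂ) ≠ 0 := by
    rw [sub_ne_zero]; exact_mod_cast h12
  have h10' : ((b 1 : ℝ) : ℂ) - (b 0 : ℂ) ≠ 0 := by
    rw [sub_ne_zero]; exact_mod_cast (Ne.symm h01)
  have h20' : ((b 2 : ℝ) : ℂ) - (b 0 : ℂ) ≠ 0 := by
    rw [sub_ne_zero]; exact_mod_cast (Ne.symm h02)
  have h21' : ((b 2 : ℝ) : ℂ) - (b 1 : ℂ) ≠ 0 := by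
    rw [sub_ne_zero]; exact_mod_cast (Ne.symm h12)
  have hD := dblD_ne_zero b h01 h02 h12
  have hI : I ≠ 0 := Complex.I_ne_zero
  rw [re_atomA0_closed b h01 h02 h12, im_atomA0_closed b h01 h02 h12, atomAN_closed b h01 h02 h12]
  unfold extremalDD extremalDDD
  simp only [Fin.sum_univ_three, clampedCoeff_succ_zero, clampedCoeff_succ_one, clampedCoeff_succ_two, (eval_aux b 0).1,
    (eval_aux b 1).1, (eval_aux b 2).1]
  simp only [clampedCoeff1, clampedCoeff2, clampedCoeff3, negIpi_sq, negIpi_cube]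
  push_cast
  field_simp
  unfold dblQ
  ring_nf
  simp only [Complex.I_sq, Complex.I_pow_three]
  ring_nf

end Clamped

end Det

end Literature.NumberTheory.LFunctions.Zhang2022
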